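import Summits.AtomisticToContinuum.Crystallization.Theorems.FrustratedLawDichotomySphericalGauge
import Summits.AtomisticToContinuum.Crystallization.Theorems.FrustratedLawDichotomyScalarBoundsPSharp

/-!
# FrustratedLawDichotomy · crux `AperiodicFrustratedLawGap` (stmt-AtomisticToContinuum-27623) — THE ROTATION GAUGE FOR P's SCALAR BOUNDS
# IN COORDINATES: `LinkPairBound θ D₀ ρ Pat ⟸ GaugedLinkPairBound θ D₀ ρ Pat u₀ u₁` (decomp-a2c, prover hand 2, gen 11)

The certificate format of record for P's four scalar bounds is a coordinate branch-and-bound over the GAUGE-FIXED 33-parameter link set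
(critic row 472 (C)); the thinnest one is the `√3`-bound, now at the literal `42/25` (p825734).  `LinkPairBound` (p823632) quantifies over
all links `p : Pat → ℝ³`; its hypotheses are norms of differences inside the cluster `{0} ∪ range p` and its conclusion is a distance, so
everything is invariant under linear isometries.  This file fixes the gauge by a contact pair `(u₀, u₁)` of the pattern:

* `GaugedLinkPairBound θ D₀ ρ Pat u₀ u₁` — `LinkPairBound` restricted to links with `p u₀` on the positive `z`-axis and `p u₁` in the
  half-plane `{y = 0, x ≥ 0}`;
* ★ `linkPairBound_of_gauged : dist u₀ u₁ = 1 → 0 ≤ θ → θ ≤ 1/2 → GaugedLinkPairBound θ D₀ ρ Pat u₀ u₁ → LinkPairBound θ D₀ ρ Pat`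
  (adapted frame `exists_adapted_basis` of `…SphericalGauge`, transport by `b.repr`; `bondLike_image` moves the coupled windows);
* literal corollaries: `linkPairBound_sqrt3_of_gauged` / `linkDiagonalBound_of_gauged` (any contact pair as gauge) and the crux by name
  `aperiodicFrustratedLawGap_of_gaugedScalarBounds₁₆₈` (G, the four gauged scalar bounds at `42/25`, `6/5`, M).
`[folklore]`; one definition; no `sorry`; no `instance`/`notation`.
-/

noncomputable section

namespace Summit.AtomisticToContinuum.Crystallization.Theorems.FrustratedLawDichotomyLinkPairBoundGauge

open Real RealInnerProductSpace
open Literature.Geometry.DiscreteGeometry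
open Summit.AtomisticToContinuum.Crystallization.Theses.PricedLinkCensus (ChargedEnergyGap)
open Summit.AtomisticToContinuum.Crystallization.Theorems.FrustratedLawDichotomyTwoShellRigidityCut
  (E3 CapForcing KR2Shape kr2Shape_of_cut aperiodicFrustratedLawGap_of_cut noFrustratedPeriodicMinimiser_of_cut)
open Summit.AtomisticToContinuum.Crystallization.Theorems.FrustratedLawDichotomyCappedRigidityCert (CappedCert)
open Summit.AtomisticToContinuum.Crystallization.Theorems.FrustratedLawDichotomyCappedRigidityCertPatterns (cappedRigidity_of_cert)
open Summit.AtomisticToContinuum.Crystallization.Theorems.FrustratedLawDichotomyLinkCert (LinkCert linkClassification_of_linkCert)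
open Summit.AtomisticToContinuum.Crystallization.Theorems.FrustratedLawDichotomyNoTwistCert (BondLike)
open Summit.AtomisticToContinuum.Crystallization.Theorems.FrustratedLawDichotomyCapMatchOfDiagonal (LinkDiagonalBound)
open Summit.AtomisticToContinuum.Crystallization.Theorems.FrustratedLawDichotomyNoTwistOfPairBound
  (LinkPairBound linkDiagonalBound_iff_pairBound)
open Summit.AtomisticToContinuum.Crystallization.Theorems.FrustratedLawDichotomySphericalLinkCert
  (inner_unit_le_of_dist_ge le_inner_unit_of_dist_le)
open Summit.AtomisticToContinuum.Crystallization.Theorems.FrustratedLawDichotomySphericalGauge (exists_adapted_basis)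
open Summit.AtomisticToContinuum.Crystallization.Theorems.FrustratedLawDichotomyScalarBoundsPSharp
  (capForcing_hundredth_of_scalarBounds₁₆₈)

/-! ### §1 The gauged statement -/

/-- **`GaugedLinkPairBound θ D₀ ρ Pat u₀ u₁`** — `LinkPairBound θ D₀ ρ Pat` restricted to links in gauge: `p u₀ = (0, 0, r₀)` with `r₀ > 0`
and `p u₁ = (x₁, 0, z₁)` with `x₁ ≥ 0`. [certificate target; 36 − 3 = 33 parameters] -/
def GaugedLinkPairBound (θ D₀ ρ : ℝ) (Pat : Finset E3) (u₀ u₁ : ↥Pat) : Prop :=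
  ∀ p : ↥Pat → E3,
    (p u₀ 0 = 0 ∧ p u₀ 1 = 0 ∧ 0 < p u₀ 2) → (p u₁ 1 = 0 ∧ 0 ≤ p u₁ 0) →
    (∀ u : ↥Pat, 1 ≤ ‖p u‖ ∧ ‖p u‖ ≤ 1 + θ) → Function.Injective p →
    (∀ u : ↥Pat, BondLike θ (insert 0 (Set.range p)) 0 (p u)) →
    (∀ u v : ↥Pat, dist (u : E3) (v : E3) = 1 → BondLike θ (insert 0 (Set.range p)) (p u) (p v)) →
    (∀ u v : ↥Pat, u ≠ v → dist (u : E3) (v : E3) ≠ 1 → min ‖p u‖ ‖p v‖ < ‖p u - p v‖) →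
    ∀ a c : ↥Pat, dist (a : E3) (c : E3) = ρ → D₀ ≤ ‖p a - p c‖

/-! ### §2 Transport of the coupled windows by a linear isometry -/

/-- `BondLike` is transported by a linear isometric equivalence. [folklore] -/
theorem bondLike_image (f : E3 ≃ₗᵢ[ℝ] E3) {θ : ℝ} {K : Set E3} {X Y : E3} (h : BondLike θ K X Y) :
    BondLike θ (f '' K) (f X) (f Y) := by
  refine ⟨?_, ?_⟩
  · rintro _ ⟨Z, hZ, rfl⟩ hne
    have hne' : Z ≠ X := fun e => hne (by rw [e])
    have := h.1 Z hZ hne'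
    rwa [← f.map_sub, ← f.map_sub, f.norm_map, f.norm_map]
  · rintro _ ⟨Z, hZ, rfl⟩ hne
    have hne' : Z ≠ Y := fun e => hne (by rw [e])
    have := h.2 Z hZ hne'
    rwa [← f.map_sub, ← f.map_sub, f.norm_map, f.norm_map]

/-- The cluster of the transported link is the image of the cluster. [folklore] -/
theorem cluster_image (f : E3 ≃ₗᵢ[ℝ] E3) {ι : Type*} (p : ι → E3) :
    insert (0 : E3) (Set.range (fun u => f (p u))) = f '' insert 0 (Set.range p) := by
  rw [Set.image_insert_eq, f.map_zero, ← Set.range_comp]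
  rfl

/-! ### §3 The reduction -/

/-- ★ **THE GAUGE REDUCTION `GaugedLinkPairBound θ D₀ ρ Pat u₀ u₁ → LinkPairBound θ D₀ ρ Pat`** for any pattern contact pair `(u₀, u₁)`
(`0 ≤ θ ≤ 1/2`). [folklore] -/
theorem linkPairBound_of_gauged {θ D₀ ρ : ℝ} {Pat : Finset E3} {u₀ u₁ : ↥Pat} (h01 : dist (u₀ : E3) (u₁ : E3) = 1)
    (hθ : 0 ≤ θ) (hθ1 : θ ≤ 1 / 2) (hG : GaugedLinkPairBound θ D₀ ρ Pat u₀ u₁) : LinkPairBound θ D₀ ρ Pat := by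
  intro p hrad hinj hB0 hBc hN a c hac
  have hpos : ∀ u, 0 < ‖p u‖ := fun u => lt_of_lt_of_le one_pos (hrad u).1
  have hp0 : ∀ u, p u ≠ 0 := fun u => norm_ne_zero_iff.1 (hpos u).ne'
  have hmem : ∀ v, p v ∈ insert (0 : E3) (Set.range p) := fun v => Or.inr ⟨v, rfl⟩
  have hne01 : u₀ ≠ u₁ := by
    intro e; rw [e, dist_self] at h01; exact zero_ne_one h01
  -- the unit directions of p u₀, p u₁ are neither parallel nor antiparallel
  set n : E3 := ‖p u₀‖⁻¹ • p u₀ with hn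
  set m : E3 := ‖p u₁‖⁻¹ • p u₁ with hm
  have hn1 : ‖n‖ = 1 := by rw [hn, norm_smul, norm_inv, norm_norm, inv_mul_cancel₀ (hpos u₀).ne']
  have hm1 : ‖m‖ = 1 := by rw [hm, norm_smul, norm_inv, norm_norm, inv_mul_cancel₀ (hpos u₁).ne']
  have ht : ⟪n, m⟫ ^ 2 < 1 := by
    have hd0 : ‖p u₀‖ ≤ (1 + θ) * ‖p u₀ - p u₁‖ := by
      have := (hB0 u₀).2 (p u₁) (hmem u₁) (fun e => hne01 (hinj e).symm)
      rwa [zero_sub, norm_neg] at this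
    have hd1 : ‖p u₁‖ ≤ (1 + θ) * ‖p u₀ - p u₁‖ := by
      have := (hB0 u₁).2 (p u₀) (hmem u₀) (fun e => hne01 (hinj e))
      rwa [zero_sub, norm_neg, norm_sub_rev] at this
    have hup : ⟪n, m⟫ ≤ 1 - (1 + θ)⁻¹ ^ 2 / 2 :=
      inner_unit_le_of_dist_ge hθ hθ1 (hrad u₀).1 (hrad u₀).2 (hrad u₁).1 (hrad u₁).2 hd0 hd1
    have hc0 : ‖p u₀ - p u₁‖ ≤ (1 + θ) * ‖p u₀‖ := by
      have := (hBc u₀ u₁ h01).1 0 (Or.inl rfl) (Ne.symm (hp0 u₀))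
      rwa [sub_zero] at this
    have hc1 : ‖p u₀ - p u₁‖ ≤ (1 + θ) * ‖p u₁‖ := by
      have := (hBc u₀ u₁ h01).2 0 (Or.inl rfl) (Ne.symm (hp0 u₁))
      rwa [sub_zero] at this
    have hlo : 1 - (1 + θ) ^ 2 / 2 ≤ ⟪n, m⟫ := le_inner_unit_of_dist_le (hrad u₀).1 (hrad u₁).1 hc0 hc1
    have h3 : 0 < (1 + θ)⁻¹ ^ 2 := by positivity
    have h4 : (1 + θ) ^ 2 < 4 := by nlinarith
    have hlo' : -1 < ⟪n, m⟫ := by linarith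
    have hhi : ⟪n, m⟫ < 1 := by linarith
    nlinarith
  obtain ⟨b, hb2, hb1m, hb0m⟩ := exists_adapted_basis hn1 hm1 ht
  -- transport
  set f : E3 ≃ₗᵢ[ℝ] EuclideanSpace ℝ (Fin 3) := b.repr with hf
  set p' : ↥Pat → E3 := fun u => f (p u) with hp'
  have hnorm : ∀ u, ‖p' u‖ = ‖p u‖ := fun u => f.norm_map (p u)
  have hsub : ∀ u v, ‖p' u - p' v‖ = ‖p u - p v‖ := fun u v => by rw [hp']; simp only; rw [← f.map_sub, f.norm_map]
  have hcoord : ∀ u (i : Fin 3), p' u i = ⟪b i, p u⟫ := fun u i => b.repr_apply_apply (p u) i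
  have hclu : insert (0 : E3) (Set.range p') = f '' insert 0 (Set.range p) := cluster_image f p
  -- gauge conditions
  have hpu₀ : p u₀ = ‖p u₀‖ • n := by rw [hn, smul_smul, mul_inv_cancel₀ (hpos u₀).ne', one_smul]
  have hpu₁ : p u₁ = ‖p u₁‖ • m := by rw [hm, smul_smul, mul_inv_cancel₀ (hpos u₁).ne', one_smul]
  have hg0 : p' u₀ 0 = 0 ∧ p' u₀ 1 = 0 ∧ 0 < p' u₀ 2 := by
    refine ⟨?_, ?_, ?_⟩
    · rw [hcoord, hpu₀, real_inner_smul_right, ← hb2, b.orthonormal.inner_eq_zero (by decide), mul_zero]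
    · rw [hcoord, hpu₀, real_inner_smul_right, ← hb2, b.orthonormal.inner_eq_zero (by decide), mul_zero]
    · rw [hcoord, hpu₀, real_inner_smul_right, ← hb2, real_inner_self_eq_norm_sq, b.orthonormal.norm_eq_one]
      have := hpos u₀; positivity
  have hg1 : p' u₁ 1 = 0 ∧ 0 ≤ p' u₁ 0 := by
    refine ⟨?_, ?_⟩
    · rw [hcoord, hpu₁, real_inner_smul_right, hb1m, mul_zero]
    · rw [hcoord, hpu₁, real_inner_smul_right]; exact mul_nonneg (norm_nonneg _) hb0m
  -- the hypotheses transported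
  have key := hG p' hg0 hg1 (fun u => by rw [hnorm]; exact hrad u) (f.injective.comp hinj)
    (fun u => by
      have h := bondLike_image f (hB0 u)
      rw [f.map_zero] at h
      rwa [hclu])
    (fun u v huv => by have h := bondLike_image f (hBc u v huv); rwa [hclu])
    (fun u v huv hd => by rw [hnorm, hnorm, hsub]; exact hN u v huv hd) a c hac
  rwa [hsub] at key

/-! ### §4 Literals and the column by name -/

/-- **`√3`-pairs at `θ = 1/100`, `D₀ = 42/25`, from the gauged statement** (any contact pair as gauge). [folklore] -/
theorem linkPairBound_sqrt3_of_gauged {Pat : Finset E3} {u₀ u₁ : ↥Pat} (h01 : dist (u₀ : E3) (u₁ : E3) = 1)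
    (h : GaugedLinkPairBound (1 / 100) (42 / 25) (Real.sqrt 3) Pat u₀ u₁) :
    LinkPairBound (1 / 100) (42 / 25) (Real.sqrt 3) Pat :=
  linkPairBound_of_gauged h01 (by norm_num) (by norm_num) h

/-- **Square diagonals at `θ = 1/100`, `d₀ = 6/5`, from the gauged statement.** [folklore] -/
theorem linkDiagonalBound_of_gauged {Pat : Finset E3} {u₀ u₁ : ↥Pat} (h01 : dist (u₀ : E3) (u₁ : E3) = 1)
    (h : GaugedLinkPairBound (1 / 100) (6 / 5) (Real.sqrt 2) Pat u₀ u₁) : LinkDiagonalBound (1 / 100) (6 / 5) Pat :=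
  linkDiagonalBound_iff_pairBound.2 (linkPairBound_of_gauged h01 (by norm_num) (by norm_num) h)

/-- ★ **`AperiodicFrustratedLawGap` (crux of item 27623) BY NAME from the GAUGED scalar bounds**: `MuEquilibriumDoor ∧ ChargedEnergyGap ∧
LinkCert(1/100)`, gauged `√3`-bounds at `42/25` and gauged diagonal bounds at `6/5` (fcc and hcp, each with its own contact pair as gauge),
`CappedCert(1/100,1/20)` ×2. [folklore] -/
theorem aperiodicFrustratedLawGap_of_gaugedScalarBounds₁₆₈
    (hDoor : Summit.AtomisticToContinuum.Crystallization.Theses.GrainCoreNetworkSplit.MuEquilibriumDoor) (hgap : ChargedEnergyGap)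
    (hG : LinkCert (1 / 100))
    {f₀ f₁ : ↥fccKissingPattern} (hf01 : dist (f₀ : E3) (f₁ : E3) = 1)
    {h₀ h₁ : ↥hcpKissingPattern} (hh01 : dist (h₀ : E3) (h₁ : E3) = 1)
    (hBf : GaugedLinkPairBound (1 / 100) (42 / 25) (Real.sqrt 3) fccKissingPattern f₀ f₁)
    (hBh : GaugedLinkPairBound (1 / 100) (42 / 25) (Real.sqrt 3) hcpKissingPattern h₀ h₁)
    (hDf : GaugedLinkPairBound (1 / 100) (6 / 5) (Real.sqrt 2) fccKissingPattern f₀ f₁)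
    (hDh : GaugedLinkPairBound (1 / 100) (6 / 5) (Real.sqrt 2) hcpKissingPattern h₀ h₁)
    (hMf : CappedCert (1 / 100) (1 / 20) fccKissingPattern) (hMh : CappedCert (1 / 100) (1 / 20) hcpKissingPattern) :
    Summit.AtomisticToContinuum.Crystallization.Theses.FrustratedLawDichotomy.AperiodicFrustratedLawGap :=
  aperiodicFrustratedLawGap_of_cut hDoor hgap (linkClassification_of_linkCert hG)
    (capForcing_hundredth_of_scalarBounds₁₆₈ (linkPairBound_sqrt3_of_gauged hf01 hBf) (linkPairBound_sqrt3_of_gauged hh01 hBh)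
      (linkDiagonalBound_of_gauged hf01 hDf) (linkDiagonalBound_of_gauged hh01 hDh))
    (cappedRigidity_of_cert hMf hMh)

/-- **Item 26654 `NoFrustratedPeriodicMinimiser`, door-free, from the gauged scalar bounds.** [folklore] -/
theorem noFrustratedPeriodicMinimiser_of_gaugedScalarBounds₁₆₈ (hgap : ChargedEnergyGap) (hG : LinkCert (1 / 100))
    {f₀ f₁ : ↥fccKissingPattern} (hf01 : dist (f₀ : E3) (f₁ : E3) = 1)
    {h₀ h₁ : ↥hcpKissingPattern} (hh01 : dist (h₀ : E3) (h₁ : E3) = 1)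
    (hBf : GaugedLinkPairBound (1 / 100) (42 / 25) (Real.sqrt 3) fccKissingPattern f₀ f₁)
    (hBh : GaugedLinkPairBound (1 / 100) (42 / 25) (Real.sqrt 3) hcpKissingPattern h₀ h₁)
    (hDf : GaugedLinkPairBound (1 / 100) (6 / 5) (Real.sqrt 2) fccKissingPattern f₀ f₁)
    (hDh : GaugedLinkPairBound (1 / 100) (6 / 5) (Real.sqrt 2) hcpKissingPattern h₀ h₁)
    (hMf : CappedCert (1 / 100) (1 / 20) fccKissingPattern) (hMh : CappedCert (1 / 100) (1 / 20) hcpKissingPattern) :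
    Summit.AtomisticToContinuum.Crystallization.Theses.PeriodicChargeSplit.NoFrustratedPeriodicMinimiser :=
  noFrustratedPeriodicMinimiser_of_cut hgap (linkClassification_of_linkCert hG)
    (capForcing_hundredth_of_scalarBounds₁₆₈ (linkPairBound_sqrt3_of_gauged hf01 hBf) (linkPairBound_sqrt3_of_gauged hh01 hBh)
      (linkDiagonalBound_of_gauged hf01 hDf) (linkDiagonalBound_of_gauged hh01 hDh))
    (cappedRigidity_of_cert hMf hMh)

end Summit.AtomisticToContinuum.Crystallization.Theorems.FrustratedLawDichotomyLinkPairBoundGauge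

end
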